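import Summits.CriticalPhenomena.PercolationContinuityZ3.Theses.PercNonProliferation
import Summits.CriticalPhenomena.PercolationContinuityZ3.Theses.PercBudgetLadder
import Summits.CriticalPhenomena.PercolationContinuityZ3.Theorems.PercNonProliferationNonProliferationRatioDichotomy
import HarnessLib

/-!
# Crux `PercNonProliferation.NonProliferation` (stmt-CriticalPhenomena-4444) is implied by the TARGET
# `PercBudgetLadder.CritAnnulusBlockedIO` (stmt-CriticalPhenomena-5247) — cross-route bridge

Lead c2 of line `boundary-pinning` (gen 5, ratio dichotomy). Lands with `--supports stmt-CriticalPhenomena-4444`;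
closes nothing by itself.

`CritAnnulusBlockedIO` (route `PercBudgetLadder`, rank 0 target): there are an aspect ratio `l ≥ 2` and `c > 0`
such that for infinitely many `n` the critical annulus `B(n) → ∂ⁱⁿB(l n)` of `ℤ³` is blocked (no open path
inside `B(l n)` from `box 3 n` to `innerBoundary (zdGraph 3) (box 3 (l n))`) with `P_{p_c}`-probability `≥ c`.
This is, up to the spelling of "infinitely often" (`∀ N, ∃ n ≥ N` versus `∃ᶠ n in atTop`), exactly the hypothesis
of the landed dichotomy bridge `nonProliferation_of_frequently_blocked` (BK at ratio `l` + the bulk covering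
of line `boundary-pinning`), so the target of `PercBudgetLadder` implies the crux of `PercNonProliferation`:
`nonProliferation_of_critAnnulusBlockedIO`. Consequently (with the proved glue `LadderReachesTarget` of that
route) `BudgetTightness → PinholeClosing → NonProliferation` as well (`nonProliferation_of_budgetLadder`).

For the planners: `CritAnnulusBlockedIO` closes the summit on its own (`PercBudgetLadder.SufficesTarget` with
`BlockingVanishesOfTheta`, both proved), so this bridge does not make the crux easier — it records that the
crux's content beyond the blocking routes lies entirely in the sure-crossing regime
(`crossing_tendsto_one_of_not_nonProliferation`).
-/

noncomputable section

namespace Summit.CriticalPhenomena.PercolationContinuityZ3.Theorems.NonProliferation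

open MeasureTheory Filter Topology
open Literature.Probability.LatticeModels Literature.Probability.Percolation

/-- **The target of route `PercBudgetLadder` implies the crux of route `PercNonProliferation`:**
`CritAnnulusBlockedIO → NonProliferation` (i.o. blocking of the critical annulus at one aspect ratio `l ≥ 2`
gives, by BK at ratio `l` and the mid-sphere covering, `M` and `c = 1/2` with `P_{p_c}(N_n ≤ M) ≥ 1/2` along
`n = 2 l m + 2`; `nonProliferation_of_frequently_blocked`). -/
theorem nonProliferation_of_critAnnulusBlockedIO :
    Summit.CriticalPhenomena.PercolationContinuityZ3.Theses.PercBudgetLadder.CritAnnulusBlockedIO →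
    Summit.CriticalPhenomena.PercolationContinuityZ3.Theses.PercNonProliferation.NonProliferation := by
  rintro ⟨l, c, hl, hc, hio⟩
  refine nonProliferation_of_frequently_blocked ⟨l, hl, c, hc, ?_⟩
  rw [frequently_atTop]
  intro N
  obtain ⟨n, hn, hbound⟩ := hio N
  exact ⟨n, hn, hbound⟩

/-- **The budget ladder reaches the crux:** `LadderReachesTarget → BudgetTightness → PinholeClosing →
NonProliferation` (the proved glue of route `PercBudgetLadder` composed with
`nonProliferation_of_critAnnulusBlockedIO`; all three hypotheses are decls of that route, the first proved
there as `ladderReachesTarget_proof`). -/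
theorem nonProliferation_of_budgetLadder
    (hL : Summit.CriticalPhenomena.PercolationContinuityZ3.Theses.PercBudgetLadder.LadderReachesTarget)
    (hBT : Summit.CriticalPhenomena.PercolationContinuityZ3.Theses.PercBudgetLadder.BudgetTightness)
    (hPC : Summit.CriticalPhenomena.PercolationContinuityZ3.Theses.PercBudgetLadder.PinholeClosing) :
    Summit.CriticalPhenomena.PercolationContinuityZ3.Theses.PercNonProliferation.NonProliferation :=
  nonProliferation_of_critAnnulusBlockedIO (hL hBT hPC)

end Summit.CriticalPhenomena.PercolationContinuityZ3.Theorems.NonProliferation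

end
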